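import Literature.Analysis.FluidPDE.ClassicalNSHorizonPatching
import Literature.Analysis.FluidPDE.ClassicalContinuationAPriori
import Literature.Analysis.FluidPDE.CheskidovShvydkoyRegularProofs
import Literature.Analysis.FluidPDE.NSTaoClassOfSobolevDatum
import Literature.Analysis.FluidPDE.AxisymmetricNoSwirlGlobal
import HarnessLib

/-!
# The blow-up alternative for smooth finite-energy solutions on `ℝ³`: global existence on every
# closed slab, or a maximal finite-energy classical solution whose sup norm blows up

Analysis/FluidPDE **proofs file** (theorems only: no definitions, no named facts, no `sorry`).
Leray's structure theorem in its simplest qualitative form, for the class in which the Clay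
problem (A)/(C) is posed — classical solutions of the unforced Navier–Stokes system on `ℝ³`
(`ν > 0`), jointly smooth on closed slabs `[0, T] × ℝ³`, with finite energy
`sup_{[0,T]} ∫ |u(t)|² < ∞` (Tao 2013, Def. 1.1 with (6): «smooth finite energy solutions») —
issued from a smooth divergence-free datum with all derivatives in `L²` (an `H^∞` datum; Clay's
class (4) is contained in it):

* `exists_finiteEnergy_classical_Icc_of_sobolevDatum` — LOCAL EXISTENCE in this class: some closed
  slab `[0, T₀]`, `T₀ > 0`, carries a finite-energy classical solution from `u₀` (Tao 2013,
  Thm. 5.4 (ii)+(iv), tree theorem `tao2011_smooth_local_existence_holds`; the energy bound is the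
  `k = 0` Sobolev bound of Tao's class);
* `finiteEnergy_classical_dichotomy` — THE ALTERNATIVE: either every closed slab `[0, T]`, `T > 0`,
  carries a finite-energy classical solution from `u₀` (equivalently, by the tree's patching theorem
  `IsClassicalNSSolutionOn.exists_Ici_of_forall_Icc_finiteEnergy`, there is a smooth solution on
  `[0, ∞) × ℝ³` with bounded energy — Fefferman's class (A)), or there are a time `T* > 0` and a
  classical solution `(u, p)` on the half-open slab `[0, T*) × ℝ³` from `u₀`, with energy bounded on
  `[0, T*)`, whose velocity is UNBOUNDED on `[0, T*) × ℝ³` (`∀ M, ∃ t < T*, ∃ x, M < |u(t,x)|`), and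
  such that NO closed slab `[0, T]` with `T ≥ T*` carries a finite-energy classical solution from
  `u₀` (`T*` is the maximal time of existence in the class) (Leray 1934, §33 «un tel mouvement
  régulier … devient irrégulier à l'instant `T*` … `max |u|` augmente indéfiniment»;
  Robinson–Rodrigo–Sadowski 2016, Thm. 8.17 with the maximal-time argument of Thm. 12.3;
  Ożański–Pooley 2018, §3.3 «Characterisation of singularities»).

## The proof (every input is a theorem of the tree)

Let `𝒯` be the set of horizons `T > 0` whose closed slab carries a finite-energy classical solution
from `u₀`; it is an initial segment (restriction) and nonempty (local existence). If `𝒯` is not all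
of `(0, ∞)` it is bounded; put `T* := sup 𝒯`. Solutions on the slabs `[0, T*(n+1)/(n+2)]` agree at
common times (Tao's uniqueness of smooth finite-energy solutions, Cor. 11.4 —
`IsClassicalNSSolutionOn.eq_of_finiteEnergy`) and glue to a classical solution on `[0, T*)`
(`IsClassicalNSSolutionOn.exists_glue_Ico_right`), whose energy is bounded uniformly by Tao's
Lemma 8.1 (`tao_finite_energy_smooth_energy_bound_holds`: `sup_t ∫|u(t)|² ≤ C ∫|u₀|²`, `C`
absolute). If its velocity were bounded by `M` on `[0, T*) × ℝ³`, the continuation theorem under an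
a priori bound (`exists_classical_extension_Icc_of_apriori_bound`, RRS Thm. 8.17 / Leray §33 in the
tree) applied from `[0, T*/2]` up to `T* + 1` would produce a finite-energy classical solution on
`[0, T* + 1]`: its a priori hypothesis holds on horizons `T' < T*` by uniqueness, at `T' = T*` by
uniqueness on `[0, T*)` and continuity at `t = T*`, and vacuously beyond `T*` (no such continuation
exists by the definition of `T*`) — contradiction. Finally a finite-energy classical solution on the
closed slab `[0, T*]` would be bounded there (Tao's class: `exists_norm_le_of_sobolevDatum`) and
equal to the glued one on `[0, T*)`, contradicting the blow-up; beyond `T*` there is none by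
definition.

## References

* J. Leray, *Sur le mouvement d'un liquide visqueux emplissant l'espace*, Acta Math. 63 (1934),
  §33 (structure theorem, `max |u| → ∞` at the end of a regular epoch). [Leray1934]
* J. C. Robinson, J. L. Rodrigo, W. Sadowski, *The Three-Dimensional Navier–Stokes Equations*, CUP
  (2016), Thm. 8.17 (PDF p. 131), proof of Thm. 12.3 (p. 170). [RobinsonRodrigoSadowski2016]
* W. S. Ożański, B. C. Pooley, *Leray's fundamental work on the Navier–Stokes equations*, LMS
  Lecture Notes 452 (2018) = arXiv:1708.09787, §3.2–§3.3. [OzanskiPooley2018]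
* T. Tao, *Localisation and compactness properties of the Navier–Stokes global regularity problem*,
  Anal. PDE 6 (2013) = arXiv:1108.1165: Def. 1.1, Thm. 5.4, Lemma 8.1, Cor. 11.1, Cor. 11.4. [Tao2011]
* C. L. Fefferman, *Existence and smoothness of the Navier–Stokes equation*, CMI (2006), (A), (C)
  with (4)–(7). [FeffermanClay2006]
-/

noncomputable section

open MeasureTheory Set Function Filter Topology
open scoped ENNReal NNReal ContDiff

namespace Literature.Analysis.FluidPDE

variable {ν : ℝ} {u₀ : EuclideanSpace ℝ (Fin 3) → EuclideanSpace ℝ (Fin 3)}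

/-- **Local existence in the class of smooth finite-energy solutions** (Tao 2013, Thm. 5.4
(ii)+(iv)): for `ν > 0` and a smooth divergence-free datum with all derivatives in `L²`, some closed
slab `[0, T₀] × ℝ³`, `T₀ > 0`, carries a classical solution of the unforced system from `u₀` with
finite energy `sup_{[0,T₀]} ∫ |u(t)|² < ∞` (the `k = 0` bound of Tao's class `L^∞_t H^k_x`).
[cite: Tao2011, Thm. 5.4 (ii)+(iv) (arXiv Thm. 31)] -/
theorem exists_finiteEnergy_classical_Icc_of_sobolevDatum (hν : 0 < ν) (hu₀ : ContDiff ℝ ∞ u₀)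
    (hdiv : VectorCalculus.IsDivFree u₀) (hH : ∀ n : ℕ, ∫⁻ x, ‖iteratedFDeriv ℝ n u₀ x‖ₑ ^ 2 < ⊤) :
    ∃ T₀ : ℝ, 0 < T₀ ∧
      ∃ (u : ℝ → EuclideanSpace ℝ (Fin 3) → EuclideanSpace ℝ (Fin 3))
        (p : ℝ → EuclideanSpace ℝ (Fin 3) → ℝ),
        IsClassicalNSSolutionOn (Icc 0 T₀) ν 0 u p ∧ u 0 = u₀ ∧
          ∃ A : ℝ≥0∞, A < ⊤ ∧ ∀ t ∈ Icc 0 T₀, ∫⁻ x, ‖u t x‖ₑ ^ 2 ≤ A := by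
  obtain ⟨c, hc, htao⟩ := tao2011_smooth_local_existence_holds
  -- the `H¹` size of the datum
  set Atop : ℝ≥0∞ := (∫⁻ x, ‖u₀ x‖ₑ ^ 2) +
    ∫⁻ x, ENNReal.ofReal (frobeniusNormSq (fderiv ℝ u₀ x)) with hAtop
  have hAfin : Atop < ⊤ := by
    refine ENNReal.add_lt_top.2 ⟨?_, ?_⟩
    · rw [lintegral_enorm_sq_eq_lintegral_iteratedFDeriv_zero]; exact hH 0
    · exact lt_of_le_of_lt (lintegral_frobeniusNormSq_le_three_mul u₀)
        (ENNReal.mul_lt_top (by simp) (hH 1))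
  set A : ℝ := Atop.toReal with hAdef
  have hA0 : 0 ≤ A := ENNReal.toReal_nonneg
  have hAle : Atop ≤ ENNReal.ofReal A := (ENNReal.ofReal_toReal hAfin.ne).ge
  -- the lifespan `T₀ = c ν³ / (A² + 1)`
  set T₀ : ℝ := c * ν ^ 3 / (A ^ 2 + 1) with hT₀def
  have hT₀ : 0 < T₀ := by positivity
  have hT₀c : A ^ 2 * T₀ ≤ c * ν ^ 3 := by
    rw [hT₀def, mul_div_assoc', div_le_iff₀ (by positivity)]
    nlinarith [sq_nonneg A, mul_pos hc (pow_pos hν 3)]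
  obtain ⟨u, p, hcl, hu0, hsob, -, -, -⟩ := htao hν hT₀ hu₀ hdiv hH hA0 hAle hT₀c
  obtain ⟨C, hC⟩ := hsob 0
  refine ⟨T₀, hT₀, u, p, hcl, hu0, C, ENNReal.coe_lt_top, fun t ht => ?_⟩
  rw [lintegral_enorm_sq_eq_lintegral_iteratedFDeriv_zero]
  exact hC t ht

/-- **The blow-up alternative for smooth finite-energy solutions on `ℝ³`.** Let `ν > 0` and let
`u₀` be smooth, divergence free, with all derivatives in `L²`. Then EITHER every closed slab
`[0, T] × ℝ³`, `T > 0`, carries a classical solution of the unforced system from `u₀` with finite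
energy (hence, by `IsClassicalNSSolutionOn.exists_Ici_of_forall_Icc_finiteEnergy`, a smooth solution
on `[0, ∞) × ℝ³` with bounded energy exists), OR there are `T* > 0` and a classical solution `(u, p)`
on `[0, T*) × ℝ³` from `u₀` with energy bounded on `[0, T*)`, velocity UNBOUNDED on `[0, T*) × ℝ³`,
and such that no closed slab `[0, T]`, `T ≥ T*`, carries a finite-energy classical solution from
`u₀`. (Leray's structure theorem, qualitative form: the regular solution exists up to a time `T*` at
which `max |u|` becomes infinite, unless it exists for all time.) See the module docstring for the
proof from the tree's local existence, uniqueness, energy, gluing and continuation theorems.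
[cite: Leray1934, §33] [cite: RobinsonRodrigoSadowski2016, Thm. 8.17 with the proof of Thm. 12.3 (PDF pp. 131, 170)] [cite: Tao2011, Thm. 5.4, Lemma 8.1, Cor. 11.1, Cor. 11.4] -/
theorem finiteEnergy_classical_dichotomy (hν : 0 < ν) (hu₀ : ContDiff ℝ ∞ u₀)
    (hdiv : VectorCalculus.IsDivFree u₀) (hH : ∀ n : ℕ, ∫⁻ x, ‖iteratedFDeriv ℝ n u₀ x‖ₑ ^ 2 < ⊤) :
    (∀ T : ℝ, 0 < T →
      ∃ (u : ℝ → EuclideanSpace ℝ (Fin 3) → EuclideanSpace ℝ (Fin 3))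
        (p : ℝ → EuclideanSpace ℝ (Fin 3) → ℝ),
        IsClassicalNSSolutionOn (Icc 0 T) ν 0 u p ∧ u 0 = u₀ ∧
          ∃ A : ℝ≥0∞, A < ⊤ ∧ ∀ t ∈ Icc 0 T, ∫⁻ x, ‖u t x‖ₑ ^ 2 ≤ A) ∨
    ∃ Ts : ℝ, 0 < Ts ∧
      ∃ (u : ℝ → EuclideanSpace ℝ (Fin 3) → EuclideanSpace ℝ (Fin 3))
        (p : ℝ → EuclideanSpace ℝ (Fin 3) → ℝ),
        IsClassicalNSSolutionOn (Ico 0 Ts) ν 0 u p ∧ u 0 = u₀ ∧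
        (∃ A : ℝ≥0∞, A < ⊤ ∧ ∀ t ∈ Ico 0 Ts, ∫⁻ x, ‖u t x‖ₑ ^ 2 ≤ A) ∧
        (∀ M : ℝ, ∃ t ∈ Ico 0 Ts, ∃ x, M < ‖u t x‖) ∧
        ∀ T : ℝ, Ts ≤ T →
          ∀ (w : ℝ → EuclideanSpace ℝ (Fin 3) → EuclideanSpace ℝ (Fin 3))
            (q : ℝ → EuclideanSpace ℝ (Fin 3) → ℝ),
            IsClassicalNSSolutionOn (Icc 0 T) ν 0 w q → w 0 = u₀ →
              ¬ ∃ A : ℝ≥0∞, A < ⊤ ∧ ∀ t ∈ Icc 0 T, ∫⁻ x, ‖w t x‖ₑ ^ 2 ≤ A := by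
  classical
  by_cases hall : ∀ T : ℝ, 0 < T →
      ∃ (u : ℝ → EuclideanSpace ℝ (Fin 3) → EuclideanSpace ℝ (Fin 3))
        (p : ℝ → EuclideanSpace ℝ (Fin 3) → ℝ),
        IsClassicalNSSolutionOn (Icc 0 T) ν 0 u p ∧ u 0 = u₀ ∧
          ∃ A : ℝ≥0∞, A < ⊤ ∧ ∀ t ∈ Icc 0 T, ∫⁻ x, ‖u t x‖ₑ ^ 2 ≤ A
  · exact Or.inl hall
  right
  push Not at hall
  obtain ⟨T₁, hT₁, hnot₁⟩ := hall
  -- the `H¹` datum hypothesis of Tao's uniqueness theorem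
  have hH1 : MemLp (fderiv ℝ u₀) 2 volume := by
    have h1 : ∫⁻ x, ‖fderiv ℝ u₀ x‖ₑ ^ 2 < ⊤ := by
      refine lt_of_le_of_lt (le_of_eq (lintegral_congr fun x => ?_)) (hH 1)
      rw [← ofReal_norm, ← ofReal_norm, norm_iteratedFDeriv_one]
    exact ⟨(hu₀.continuous_fderiv (by simp)).aestronglyMeasurable,
      eLpNorm_two_lt_top_of_lintegral_enorm_sq_lt_top h1⟩
  -- the set of good horizons
  set S : Set ℝ := {T | 0 < T ∧
      ∃ (u : ℝ → EuclideanSpace ℝ (Fin 3) → EuclideanSpace ℝ (Fin 3))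
        (p : ℝ → EuclideanSpace ℝ (Fin 3) → ℝ),
        IsClassicalNSSolutionOn (Icc 0 T) ν 0 u p ∧ u 0 = u₀ ∧
          ∃ A : ℝ≥0∞, A < ⊤ ∧ ∀ t ∈ Icc 0 T, ∫⁻ x, ‖u t x‖ₑ ^ 2 ≤ A} with hSdef
  -- restriction: `S` is an initial segment of `(0, ∞)`
  have hmono : ∀ {T T' : ℝ}, 0 < T' → T' ≤ T → T ∈ S → T' ∈ S := by
    rintro T T' hT' hle ⟨-, u, p, hcl, h0, A, hA, hE⟩
    exact ⟨hT', u, p, hcl.mono (Icc_subset_Icc_right hle) (uniqueDiffOn_Icc hT'), h0, A, hA,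
      fun t ht => hE t ⟨ht.1, ht.2.trans hle⟩⟩
  have hT₁S : T₁ ∉ S := fun h => by
    obtain ⟨-, u, p, hcl, h0, A, hA, hE⟩ := h
    obtain ⟨t, ht, hlt⟩ := hnot₁ u p hcl h0 A hA
    exact (hE t ht).not_gt hlt
  have hbdd : BddAbove S := ⟨T₁, fun T hT => le_of_not_gt fun h => hT₁S (hmono hT₁ h.le hT)⟩
  -- local existence: `S` is nonempty
  obtain ⟨T₀, hT₀, hT₀sol⟩ := exists_finiteEnergy_classical_Icc_of_sobolevDatum hν hu₀ hdiv hH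
  have hT₀S : T₀ ∈ S := ⟨hT₀, hT₀sol⟩
  have hne : S.Nonempty := ⟨T₀, hT₀S⟩
  -- the maximal time
  set Ts : ℝ := sSup S with hTsdef
  have hT₀le : T₀ ≤ Ts := le_csSup hbdd hT₀S
  have hTs : 0 < Ts := hT₀.trans_le hT₀le
  have hbelow : ∀ T', 0 < T' → T' < Ts → T' ∈ S := by
    intro T' hT' hlt
    obtain ⟨T, hT, hT'T⟩ := exists_lt_of_lt_csSup hne hlt
    exact hmono hT' hT'T.le hT
  have habove : ∀ T, Ts < T → T ∉ S := fun T hT hTS => (le_csSup hbdd hTS).not_gt hT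
  -- the horizons `b n = T* (n+1)/(n+2) ↑ T*` and solutions on their closed slabs
  set b : ℕ → ℝ := fun n => Ts * ((n : ℝ) + 1) / ((n : ℝ) + 2) with hbdef
  have hbpos : ∀ n, 0 < b n := fun n => by rw [hbdef]; positivity
  have hblt : ∀ n, b n < Ts := fun n => by
    have h2 : (0 : ℝ) < (n : ℝ) + 2 := by positivity
    rw [hbdef, div_lt_iff₀ h2]
    nlinarith
  have hbS : ∀ n, b n ∈ S := fun n => hbelow (b n) (hbpos n) (hblt n)
  choose _hbpos' V P hV hV0 hVE using hbS
  have hb : ∀ t, t < Ts → ∃ n : ℕ, t < b n := by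
    intro t ht
    have hpos : 0 < Ts - t := sub_pos.2 ht
    obtain ⟨n, hn⟩ := exists_nat_gt (Ts / (Ts - t))
    refine ⟨n, ?_⟩
    have h1 : Ts < (n : ℝ) * (Ts - t) := (div_lt_iff₀ hpos).1 hn
    have h2 : (0 : ℝ) < (n : ℝ) + 2 := by positivity
    rw [hbdef, lt_div_iff₀ h2]
    nlinarith [hTs, (Nat.cast_nonneg n : (0 : ℝ) ≤ n)]
  -- any two of the chosen solutions agree at common times (Tao, Cor. 11.4)
  have hagree : ∀ m n, ∀ t ∈ Ico (0 : ℝ) (min (b m) (b n)), V m t = V n t := by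
    intro m n t ht
    exact (hV m).eq_of_finiteEnergy hν hH1 (hV n) (hV0 m) (hV0 n) (hVE m) (hVE n)
      ⟨ht.1, (ht.2.trans_le (min_le_left _ _)).le⟩ (ht.2.trans_le (min_le_right _ _)).le
  -- glue them on `[0, T*)`
  have hVIco : ∀ n, IsClassicalNSSolutionOn (Ico 0 (b n)) ν 0 (V n) (P n) := fun n =>
    (hV n).mono Ico_subset_Icc_self (uniqueDiffOn_Ico 0 (b n))
  obtain ⟨v, q, hv, hvn⟩ := IsClassicalNSSolutionOn.exists_glue_Ico_right (a := 0) (β := Ts)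
    (fun n => (hblt n).le) hb hVIco hagree
  have hv0 : v 0 = u₀ := (hvn 0 0 ⟨le_rfl, hbpos 0⟩).trans (hV0 0)
  -- `v` agrees with every piece, pointwise on `[0, b n]`-interior times
  have hvV : ∀ n, ∀ t ∈ Ico (0 : ℝ) (b n), v t = V n t := hvn
  -- energy of `v` on `[0, T*)`: Tao's Lemma 8.1 slab by slab, constant uniform
  obtain ⟨CL, hCLtop, hL⟩ := tao_finite_energy_smooth_energy_bound_holds
  have hE₀ : ∫⁻ x, ‖u₀ x‖ₑ ^ 2 < ⊤ := by
    rw [lintegral_enorm_sq_eq_lintegral_iteratedFDeriv_zero]; exact hH 0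
  have hvE : ∃ A : ℝ≥0∞, A < ⊤ ∧ ∀ t ∈ Ico 0 Ts, ∫⁻ x, ‖v t x‖ₑ ^ 2 ≤ A := by
    refine ⟨CL * ∫⁻ x, ‖u₀ x‖ₑ ^ 2, ENNReal.mul_lt_top hCLtop hE₀, fun t ht => ?_⟩
    obtain ⟨n, hn⟩ := hb t ht.2
    rw [hvV n t ⟨ht.1, hn⟩, ← hV0 n]
    exact (hL ν (b n) hν (hbpos n) (V n) (P n) (hV n) (hVE n)).1 t ⟨ht.1, hn.le⟩
  -- a finite-energy classical solution on a closed slab `[0, T']`, `T' ≤ T*`, equals `v` before `T*`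
  have hwv : ∀ {T' : ℝ} {w : ℝ → EuclideanSpace ℝ (Fin 3) → EuclideanSpace ℝ (Fin 3)}
      {r : ℝ → EuclideanSpace ℝ (Fin 3) → ℝ}, IsClassicalNSSolutionOn (Icc 0 T') ν 0 w r →
      w 0 = u₀ → (∃ A : ℝ≥0∞, A < ⊤ ∧ ∀ t ∈ Icc 0 T', ∫⁻ x, ‖w t x‖ₑ ^ 2 ≤ A) →
      ∀ t ∈ Icc (0 : ℝ) T', t < Ts → w t = v t := by
    intro T' w r hw hw0 hwE t ht htTs
    obtain ⟨n, hn⟩ := hb t htTs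
    rw [hvV n t ⟨ht.1, hn⟩]
    exact hw.eq_of_finiteEnergy hν hH1 (hV n) hw0 (hV0 n) hwE (hVE n) ht hn.le
  -- SUP-NORM BLOW-UP on `[0, T*)`
  have hblow : ∀ M : ℝ, ∃ t ∈ Ico 0 Ts, ∃ x, M < ‖v t x‖ := by
    by_contra hbd
    push Not at hbd
    obtain ⟨M, hM⟩ := hbd
    -- continuation from `[0, b 0]` up to `T* + 1` under the a priori bound `M`
    have hv0cl : IsClassicalNSSolutionOn (Icc 0 (b 0)) ν 0 v q :=
      hv.mono (Icc_subset_Ico_right (hblt 0)) (uniqueDiffOn_Icc (hbpos 0))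
    have hv0E : ∃ A : ℝ≥0∞, A < ⊤ ∧ ∀ t ∈ Icc 0 (b 0), ∫⁻ x, ‖v t x‖ₑ ^ 2 ≤ A := by
      obtain ⟨A, hA, hE⟩ := hvE
      exact ⟨A, hA, fun t ht => hE t ⟨ht.1, ht.2.trans_lt (hblt 0)⟩⟩
    have hT01 : b 0 ≤ Ts + 1 := by linarith [hblt 0]
    have hapriori : ∀ T' ∈ Icc (b 0) (Ts + 1),
        ∀ (w : ℝ → EuclideanSpace ℝ (Fin 3) → EuclideanSpace ℝ (Fin 3))
          (r : ℝ → EuclideanSpace ℝ (Fin 3) → ℝ),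
          IsClassicalNSSolutionOn (Icc 0 T') ν 0 w r →
          (∀ t ∈ Icc 0 (b 0), w t = v t ∧ r t = q t) →
          (∃ A : ℝ≥0∞, A < ⊤ ∧ ∀ t ∈ Icc 0 T', ∫⁻ x, ‖w t x‖ₑ ^ 2 ≤ A) →
          ∀ t ∈ Icc 0 T', ∀ x, ‖w t x‖ ≤ M := by
      intro T' hT' w r hw hagr hwE t ht x
      have hw0 : w 0 = u₀ := ((hagr 0 ⟨le_rfl, (hbpos 0).le⟩).1).trans hv0
      have hT'pos : 0 < T' := (hbpos 0).trans_le hT'.1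
      rcases lt_or_ge Ts T' with hgt | hle
      · -- beyond `T*` there is no finite-energy classical continuation at all
        exact absurd (⟨hT'pos, w, r, hw, hw0, hwE⟩ : T' ∈ S) (habove T' hgt)
      · rcases lt_or_eq_of_le (ht.2.trans hle) with htlt | hteq
        · -- before `T*`: `w = v` by uniqueness
          rw [hwv hw hw0 hwE t ht htlt]
          exact hM t ⟨ht.1, htlt⟩ x
        · -- at `t = T*` (so `T' = T*`): by continuity of `s ↦ w s x` on `[0, T']`
          have hT'eq : T' = Ts := le_antisymm hle (by rw [← hteq]; exact ht.2)
          rw [hteq]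
          have hTsT' : Ts ∈ Icc 0 T' := ⟨hTs.le, hT'eq.ge⟩
          have hcont : ContinuousOn (fun s => w s x) (Icc 0 T') :=
            hw.smooth_velocity.continuousOn.comp (continuousOn_id.prodMk continuousOn_const)
              fun s hs => mk_mem_prod hs (mem_univ x)
          have htend : Tendsto (fun s => ‖w s x‖) (𝓝[Ico 0 Ts] Ts) (𝓝 ‖w Ts x‖) :=
            (((hcont Ts hTsT').mono fun s hs => ⟨hs.1, hs.2.le.trans hT'eq.ge⟩).tendsto).norm
          haveI : (𝓝[Ico 0 Ts] Ts).NeBot := by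
            refine mem_closure_iff_nhdsWithin_neBot.1 ?_
            rw [closure_Ico hTs.ne]
            exact right_mem_Icc.2 hTs.le
          refine le_of_tendsto htend (eventually_nhdsWithin_of_forall fun s hs => ?_)
          rw [hwv hw hw0 hwE s ⟨hs.1, hs.2.le.trans hT'eq.ge⟩ hs.2]
          exact hM s hs x
    obtain ⟨w, r, hw, hagr, hwE, -⟩ :=
      exists_classical_extension_Icc_of_apriori_bound hν (hbpos 0) hT01 hv0cl hv0E hapriori
    have hw0 : w 0 = u₀ := ((hagr 0 ⟨le_rfl, (hbpos 0).le⟩).1).trans hv0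
    exact habove (Ts + 1) (lt_add_one Ts) ⟨by linarith, w, r, hw, hw0, hwE⟩
  refine ⟨Ts, hTs, v, q, hv, hv0, hvE, hblow, fun T hTsT w r hw hw0 hwE => ?_⟩
  -- NO finite-energy classical solution on a closed slab `[0, T]`, `T ≥ T*`
  rcases hTsT.eq_or_lt with hTeq | hTgt
  · -- `T = T*`: such a solution is bounded (Tao's class) and equals `v` on `[0, T*)`
    subst hTeq
    have hEnn : ∃ C : ℝ≥0, ∀ t ∈ Icc 0 (sSup S), ∫⁻ x, ‖w t x‖ₑ ^ 2 ≤ C := by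
      obtain ⟨A, hA, hE⟩ := hwE
      exact ⟨A.toNNReal, fun t ht => (hE t ht).trans (ENNReal.coe_toNNReal hA.ne).ge⟩
    have h₀ : ∀ m : ℕ, ∫⁻ x, ‖iteratedFDeriv ℝ m (w 0) x‖ₑ ^ 2 < ⊤ := fun m => by
      rw [hw0]; exact hH m
    have hf : ∀ m : ℕ, ∃ C : ℝ≥0, ∀ t ∈ Icc 0 (sSup S),
        ∫⁻ x, ‖iteratedFDeriv ℝ m
          ((0 : ℝ → EuclideanSpace ℝ (Fin 3) → EuclideanSpace ℝ (Fin 3)) t) x‖ₑ ^ 2 ≤ C :=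
      fun m => ⟨0, fun t _ => by simp⟩
    obtain ⟨B, -, hB⟩ := hw.exists_norm_le_of_sobolevDatum hν hTs hEnn h₀ hf
    obtain ⟨t, ht, x, hMx⟩ := hblow B
    have h1 : ‖v t x‖ ≤ B := by
      rw [← hwv hw hw0 hwE t ⟨ht.1, ht.2.le⟩ ht.2]
      exact hB t ⟨ht.1, ht.2.le⟩ x
    exact absurd hMx (not_lt.2 h1)
  · exact habove T hTgt ⟨hTs.trans hTgt, w, r, hw, hw0, hwE⟩

/-- **Global form of the alternative**: for `ν > 0` and a smooth divergence-free `H^∞` datum,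
EITHER there is a classical solution of the unforced system on `[0, ∞) × ℝ³` from `u₀` with bounded
energy (Fefferman's class (A): (1)–(3), (6), (7); pressure normalised by `p(t, 0) = 0`), OR there is
a finite-energy classical solution on a maximal half-open slab `[0, T*) × ℝ³`, `0 < T* < ∞`, whose
velocity is unbounded there and beyond whose end no closed slab carries a finite-energy classical
solution from `u₀`. The first branch is assembled from the closed slabs by the tree's patching
theorem `IsClassicalNSSolutionOn.exists_Ici_of_forall_Icc_finiteEnergy` (Tao's Cor. 11.4 +
Lemma 8.1). [cite: Leray1934, §33] [cite: Tao2011, Thm. 5.4, Lemma 8.1, Cor. 11.1, Cor. 11.4] [cite: FeffermanClay2006, (A) with (6) (7) p. 2] -/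
theorem exists_global_finiteEnergy_classical_or_supBlowup (hν : 0 < ν) (hu₀ : ContDiff ℝ ∞ u₀)
    (hdiv : VectorCalculus.IsDivFree u₀) (hH : ∀ n : ℕ, ∫⁻ x, ‖iteratedFDeriv ℝ n u₀ x‖ₑ ^ 2 < ⊤) :
    (∃ (u : ℝ → EuclideanSpace ℝ (Fin 3) → EuclideanSpace ℝ (Fin 3))
        (p : ℝ → EuclideanSpace ℝ (Fin 3) → ℝ),
        IsClassicalNSSolutionOn (Ici 0) ν 0 u p ∧ u 0 = u₀ ∧ HasBoundedEnergy u ∧ ∀ t, p t 0 = 0) ∨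
    ∃ Ts : ℝ, 0 < Ts ∧
      ∃ (u : ℝ → EuclideanSpace ℝ (Fin 3) → EuclideanSpace ℝ (Fin 3))
        (p : ℝ → EuclideanSpace ℝ (Fin 3) → ℝ),
        IsClassicalNSSolutionOn (Ico 0 Ts) ν 0 u p ∧ u 0 = u₀ ∧
        (∃ A : ℝ≥0∞, A < ⊤ ∧ ∀ t ∈ Ico 0 Ts, ∫⁻ x, ‖u t x‖ₑ ^ 2 ≤ A) ∧
        (∀ M : ℝ, ∃ t ∈ Ico 0 Ts, ∃ x, M < ‖u t x‖) ∧
        ∀ T : ℝ, Ts ≤ T →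
          ∀ (w : ℝ → EuclideanSpace ℝ (Fin 3) → EuclideanSpace ℝ (Fin 3))
            (q : ℝ → EuclideanSpace ℝ (Fin 3) → ℝ),
            IsClassicalNSSolutionOn (Icc 0 T) ν 0 w q → w 0 = u₀ →
              ¬ ∃ A : ℝ≥0∞, A < ⊤ ∧ ∀ t ∈ Icc 0 T, ∫⁻ x, ‖w t x‖ₑ ^ 2 ≤ A := by
  rcases finiteEnergy_classical_dichotomy hν hu₀ hdiv hH with hall | hblow
  · have hH1 : MemLp (fderiv ℝ u₀) 2 volume := by
      have h1 : ∫⁻ x, ‖fderiv ℝ u₀ x‖ₑ ^ 2 < ⊤ := by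
        refine lt_of_le_of_lt (le_of_eq (lintegral_congr fun x => ?_)) (hH 1)
        rw [← ofReal_norm, ← ofReal_norm, norm_iteratedFDeriv_one]
      exact ⟨(hu₀.continuous_fderiv (by simp)).aestronglyMeasurable,
        eLpNorm_two_lt_top_of_lintegral_enorm_sq_lt_top h1⟩
    exact Or.inl (IsClassicalNSSolutionOn.exists_Ici_of_forall_Icc_finiteEnergy hν hH1 hall)
  · exact Or.inr hblow

end Literature.Analysis.FluidPDE
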